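import Summits.BirchSwinnertonDyer.BirchSwinnertonDyer.Theorems.QuadraticBranchSignedControlPlusEtaNonsurjCongruentAnchor
import Literature.NumberTheory.EllipticCurves.HatleyLei2019.SignedSelmerEtaCongruentMuInvariant
import HarnessLib

/-!
# Route `QuadraticBranchSignedControl` (rung K8, cell `bsd-potss`), residual crux
# `PlusEtaMainConjectureNonsurj` (stmt-BirchSwinnertonDyer-19606): the CONGRUENT-ANCHOR ROAD BY NAME —
# the displayed transfer `hHL` of seat g3's `EtaCongruentAnchor` IS the landed Literature fact
# `HatleyLei2019.thm46_etaSignedMu_eq_zero_iff_of_torsionIso` (+ Kobayashi Thm. 2.2 at `η`)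
# (seat `bsd-potss-k8eta-c2` g5, file 1)

WHAT. Seats g3/g4 of this unit typed the `μ`-TRANSFER of Hatley–Lei, Ann. Inst. Fourier 69 (2019) Thm. 4.6
at the quadratic character `η = ω^{(p−1)/2}` as a DISPLAYED hypothesis `hHL` (spelled on the Summits-side
datum `Additive.EtaSignedSelmerDualData`), pending a typer. The typer job wi-78102 has since LANDED the fact
`Literature/NumberTheory/EllipticCurves/HatleyLei2019/SignedSelmerEtaCongruentMuInvariant.lean`
(`thm46_etaSignedMu_eq_zero_iff_of_torsionIso`, statement only) together with the PROVED consequence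
`HatleyLei2019.plusEtaHasUnitContent_transfer_of_thm46 p h46 h22` — the consumer's binder list literally,
on the Literature copy `Kobayashi2003.EtaSignedSelmerDualData` of the datum. THIS FILE closes the three-line
gap the fact's docstring leaves to the consumer:

* §1 `hHL_of_thm46` — g3's displayed `hHL`, VERBATIM, is a theorem modulo the two named facts `h46`
  (Hatley–Lei Thm. 4.6, first claim) and `h22` (Kobayashi Thm. 2.2 at `η`): the Summits datum of `V` goes to
  the Literature side by the `rfl`-repackaging `Additive.EtaSignedSelmerDualData.toLiterature` (same module,
  same `Char`), the anchor hypothesis comes back field by field.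
* §2 g3's four anchor theorems RE-ISSUED with `hHL` replaced by `h46` (+ `h22`): `etaMu_of_modPCongruent`,
  `etaMu_of_modPCongruent_unitRow` (= `stub_etaMC_r0_mu`'s conclusion `μ(X⁺(V/K_∞)^η) = 0` from a congruent
  anchor / a congruent UNIT-row anchor), `etaUpperIntegral_of_modPCongruent{,_unitRow}` (= the conclusion of
  `stub_etaMC_nonCM_upper` at `(V,p)`, any rank, from a congruent anchor), and the rank-`0` composition
  `quadraticBranchPlusEtaMainConjectureAt_of_modPCongruent_of_missingLowerBoundAt`.

So, modulo NAMED PUBLISHED FACTS ONLY (h46, h22, h41 [+ hPT, hmod, hGZK, hKO for the rank-`0` composition])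
and the per-row INPUT `ModPCongruent V′ V p` (Kraus–Oesterlé certificates, kit j270119 / j270714, not
kernel-checked): `μ = 0` and the integral upper inclusion at `η` transfer from any good `a_p = 0` anchor; with
a UNIT-row anchor (`Sel_{p^∞}(W′/ℚ) = 0`, `p ∤ Tam(W′)`, seat g2's theorem) they HOLD. Census reach unchanged
(g3/g4): all 30 non-CM rows of 19606 below `5·10⁵` have CM anchors; 14 of them UNIT anchors.

HONEST FRAMING (cell `bsd-potss`; FULL-BSD rank ≤ 1 programme, HUMAN RULING D-0036/D-0074): BOOKKEEPING
THEOREMS ONLY — no definition, no new fact, no `sorry`, axioms standard. CONDITIONAL on the named facts in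
hypothesis position (the tree's standard currency; `h46` has no `_holds`: Coleman maps / Wach modules are not
in Mathlib). Nothing is proved by name toward the crux's stubs (the anchors' `μ = 0` off the unit rows is the
CM `μ`-question); 19606 stays OPEN; nothing is booked; no label / mark / count moves.
`--supports stmt-BirchSwinnertonDyer-19606`.

References: [HatleyLei2019] Thm. 4.6 (§4.2), §7 table; [Kobayashi2003] Thm. 2.2 (p. 5), Thm. 4.1 (p. 8), §4
p. 8; [LeiLoefflerZerbes2010] §5.3; [GreenbergVatsal2000] p. 2 (2); [KrausOesterle1992] Prop. 4;
[GreenbergLNM1716] §3 Prop. 3.8, §4 Lemma 4.2; [Serre1972] §1.11 Prop. 12.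
-/

set_option autoImplicit false
set_option linter.dupNamespace false

noncomputable section

open scoped Classical

open CongruenceSubgroup Field Function NumberField IsDedekindDomain WeierstrassCurve
open Literature.NumberTheory.EllipticCurves
open Literature.NumberTheory.EllipticCurves.ModularForms
open Literature.NumberTheory.EllipticCurves.Rank1Residual
open Literature.NumberTheory.EllipticCurves.Rank1Residual.Typed
open Literature.NumberTheory.GaloisRepresentations
open Literature.NumberTheory.GaloisCohomology
open Literature.NumberTheory.EllipticCurves.IwasawaAlgebra
open Literature.NumberTheory.EllipticCurves.IwasawaDual ZpExtension
open Literature.NumberTheory.EllipticCurves.GreenbergVatsal2000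
open Summit.BirchSwinnertonDyer.Rank1Residual.X11b.Levels
open Summit.BirchSwinnertonDyer.Rank1Residual.X11b
open Summit.BirchSwinnertonDyer.Rank1Residual.Additive
open Summit.BirchSwinnertonDyer.Rank1Residual.Additive.SignedTwist
open scoped ContRepresentation
open Summit.BirchSwinnertonDyer.Rank1Residual.AdditivePotMult
open Summit.BirchSwinnertonDyer.Rank1Residual.O6 (ModPCongruent)

namespace Summit.BirchSwinnertonDyer.BirchSwinnertonDyer.Theorems

namespace EtaCongruentAnchorByName

variable (p : ℕ) [hp : Fact p.Prime]

/-! ## §1 The displayed transfer `hHL` from the named fact -/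

/-- **The anchor's `μ = 0`, re-read on the Literature copy of the datum.** If every Summits-side
`η`-signed plus dual datum (`Additive.EtaSignedSelmerDualData`) of `V′` has a characteristic generator of unit
content, then so does every Literature-side datum (`Kobayashi2003.EtaSignedSelmerDualData`, the frame of the
named facts): a Literature datum IS a Summits datum field by field, with the same module and the same
characteristic ideal (`rfl`; the reverse of `Additive.EtaSignedSelmerDualData.toLiterature`). Pure
bookkeeping. [cite: Kobayashi2003, Def. 2.1 (p. 5), §4 p. 8 (the object only)]
[cite: GreenbergVatsal2000, p. 2 (2)] -/
theorem hasUnitContent_literature_of_additive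
    (V' : WeierstrassCurve ℚ) [V'.IsElliptic] [V'.IsGloballyMinimal]
    (hμ' : ∀ (K₀ : Type) [Field K₀] [NumberField K₀] [IsCyclotomicExtension {p} ℚ K₀]
        [(galRange (K := ℚ) K₀).Normal] (ηq : absoluteGaloisGroup ℚ →* ℤˣ),
        (∀ σ ∈ galRange (K := ℚ) K₀, ηq σ = 1) → ηq ≠ 1 →
      ∀ (κ : ZpExtension ℚ p) (γ : absoluteGaloisGroup ℚ),
        κ.IsCyclotomic → κ.IsTopGenerator γ → γ ∈ galRange (K := ℚ) K₀ →
      ∀ (D : EtaSignedSelmerDualData V' κ K₀ ℚ_[p] ηq γ 1) (g : IwasawaAlgebra p),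
        D.charIdeal = Ideal.span {g} → HasUnitContent g) :
    ∀ (K₀ : Type) [Field K₀] [NumberField K₀] [IsCyclotomicExtension {p} ℚ K₀]
        [(galRange (K := ℚ) K₀).Normal] (ηq : absoluteGaloisGroup ℚ →* ℤˣ),
        (∀ σ ∈ galRange (K := ℚ) K₀, ηq σ = 1) → ηq ≠ 1 →
      ∀ (κ : ZpExtension ℚ p) (γ : absoluteGaloisGroup ℚ),
        κ.IsCyclotomic → κ.IsTopGenerator γ → γ ∈ galRange (K := ℚ) K₀ →
      ∀ (D' : Kobayashi2003.EtaSignedSelmerDualData V' κ K₀ ℚ_[p] ηq γ 1) (g' : IwasawaAlgebra p),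
        D'.charIdeal = Ideal.span {g'} → HasUnitContent g' := by
  intro K₀ _ _ _ _ ηq hηq hne κ γ hκ hγ hγ₀ D' g' hg'
  -- the Literature datum re-read as a Summits datum, field by field (same module, same `Char`)
  obtain ⟨D, hD⟩ : ∃ D : EtaSignedSelmerDualData V' κ K₀ ℚ_[p] ηq γ 1, D.charIdeal = D'.charIdeal :=
    ⟨⟨D'.X, D'.conj_mem, D'.toDual, D'.bijective, D'.toDual_T_smul, D'.toDual_C_smul⟩, rfl⟩
  exact hμ' K₀ ηq hηq hne κ γ hκ hγ hγ₀ D g' (hD.trans hg')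

/-- **Seat g3's displayed transfer `hHL`, BY NAME.** Granted Hatley–Lei 2019 Thm. 4.6 (first claim; named
fact `h46 : HatleyLei2019.thm46_etaSignedMu_eq_zero_iff_of_torsionIso`) and Kobayashi 2003 Thm. 2.2 at `η`
(named fact `h22`): for `V′, V/ℚ` globally minimal elliptic, `5 ≤ p`, both good at `p` with `a_p = 0`,
`V′[p] ≅ V[p]` (`ModPCongruent V′ V p`), IF every `η`-signed plus dual datum of `V′` (Summits-side
`Additive.EtaSignedSelmerDualData`, every `K₀ = ℚ(μ_p)`, every non-trivial `{±1}`-valued `ηq`, every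
cyclotomic `(κ, γ)`) has a characteristic generator of unit content, THEN so does every `η`-datum of `V` —
VERBATIM the hypothesis `hHL` of `EtaCongruentAnchor.etaMu_of_modPCongruent` and of seat g4's
`EtaPrimeRoad` §3 / record shape. Proof: `HatleyLei2019.plusEtaHasUnitContent_transfer_of_thm46` on the
`rfl`-repackaged data (`Additive.EtaSignedSelmerDualData.toLiterature` for the datum of `V`;
`hasUnitContent_literature_of_additive` for the anchor's). CONDITIONAL on `h46`, `h22`.
[cite: HatleyLei2019, Thm. 4.6 (§4.2)] [cite: Kobayashi2003, Thm. 2.2 (p. 5), §4 p. 8]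
[cite: LeiLoefflerZerbes2010, §5.3 (Sel_2 = Sel⁺ when a_p = 0)] -/
theorem hHL_of_thm46 (h46 : HatleyLei2019.thm46_etaSignedMu_eq_zero_iff_of_torsionIso)
    (h22 : Kobayashi2003.thm22_etaSignedSelmerDual_finite_torsion) :
    ∀ (V' : WeierstrassCurve ℚ) [V'.IsElliptic] [V'.IsGloballyMinimal]
        (V : WeierstrassCurve ℚ) [V.IsElliptic] [V.IsGloballyMinimal],
        5 ≤ p → V'.HasGoodReductionAtPrime p → V'.frobeniusTrace p = 0 →
        V.HasGoodReductionAtPrime p → V.frobeniusTrace p = 0 → ModPCongruent V' V p →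
      (∀ (K₀ : Type) [Field K₀] [NumberField K₀] [IsCyclotomicExtension {p} ℚ K₀]
          [(galRange (K := ℚ) K₀).Normal] (ηq : absoluteGaloisGroup ℚ →* ℤˣ),
          (∀ σ ∈ galRange (K := ℚ) K₀, ηq σ = 1) → ηq ≠ 1 →
        ∀ (κ : ZpExtension ℚ p) (γ : absoluteGaloisGroup ℚ),
          κ.IsCyclotomic → κ.IsTopGenerator γ → γ ∈ galRange (K := ℚ) K₀ →
        ∀ (D : EtaSignedSelmerDualData V' κ K₀ ℚ_[p] ηq γ 1) (g : IwasawaAlgebra p),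
          D.charIdeal = Ideal.span {g} → HasUnitContent g) →
      (∀ (K₀ : Type) [Field K₀] [NumberField K₀] [IsCyclotomicExtension {p} ℚ K₀]
          [(galRange (K := ℚ) K₀).Normal] (ηq : absoluteGaloisGroup ℚ →* ℤˣ),
          (∀ σ ∈ galRange (K := ℚ) K₀, ηq σ = 1) → ηq ≠ 1 →
        ∀ (κ : ZpExtension ℚ p) (γ : absoluteGaloisGroup ℚ),
          κ.IsCyclotomic → κ.IsTopGenerator γ → γ ∈ galRange (K := ℚ) K₀ →
        ∀ (D : EtaSignedSelmerDualData V κ K₀ ℚ_[p] ηq γ 1) (g : IwasawaAlgebra p),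
          D.charIdeal = Ideal.span {g} → HasUnitContent g) := by
  intro V' _ _ V _ _ hp5 hgood' hap' hgood hap hcong hμ' K₀ _ _ _ _ ηq hηq hne κ γ hκ hγ hγ₀ D g hg
  have hcong' : ∃ e : V'.geomTorsion (p : ℤ) ≃+ V.geomTorsion (p : ℤ),
      ∀ (σ : Field.absoluteGaloisGroup ℚ) (P : V'.geomTorsion (p : ℤ)), e (σ • P) = σ • e P := hcong
  have key := HatleyLei2019.plusEtaHasUnitContent_transfer_of_thm46 p h46 h22 V' V hp5 hgood' hap' hgood
    hap hcong' (hasUnitContent_literature_of_additive p V' hμ')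
  have hg' : D.toLiterature.charIdeal = Ideal.span {g} := by rw [D.charIdeal_toLiterature]; exact hg
  exact key K₀ ηq hηq hne κ γ hκ hγ hγ₀ D.toLiterature g hg'

/-! ## §2 Seat g3's anchor road, re-issued with `h46` in place of the displayed `hHL` -/

/-- **`μ(X⁺(V/K_∞)^η) = 0` from a congruent anchor, BY NAME** (= `EtaCongruentAnchor.etaMu_of_modPCongruent`
with `hHL` := `hHL_of_thm46`): for good `a_p = 0` curves `V′`, `V` at `p ≥ 5` with `V′[p] ≅ V[p]`, if every
`η`-signed plus dual datum of `V′` has a characteristic generator of unit content then so does every `η`-datum of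
`V` — verbatim the conclusion `EtaMuZeroAt V p` of skeleton v3's `stub_etaMC_r0_mu`. CONDITIONAL on the named
facts `h46` (Hatley–Lei Thm. 4.6) and `h22` (Kobayashi Thm. 2.2 at `η`) and on the anchor's `μ = 0` (displayed).
[cite: HatleyLei2019, Thm. 4.6 (§4.2)] [cite: Kobayashi2003, Thm. 2.2 (p. 5), §4 p. 8]
[cite: GreenbergVatsal2000, p. 2 (2)] -/
theorem etaMu_of_modPCongruent (h46 : HatleyLei2019.thm46_etaSignedMu_eq_zero_iff_of_torsionIso)
    (h22 : Kobayashi2003.thm22_etaSignedSelmerDual_finite_torsion)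
    (V' : WeierstrassCurve ℚ) [V'.IsElliptic] [V'.IsGloballyMinimal]
    (V : WeierstrassCurve ℚ) [V.IsElliptic] [V.IsGloballyMinimal]
    (hp5 : 5 ≤ p) (hgood' : V'.HasGoodReductionAtPrime p) (hap' : V'.frobeniusTrace p = 0)
    (hgood : V.HasGoodReductionAtPrime p) (hap : V.frobeniusTrace p = 0)
    (hcong : ModPCongruent V' V p)
    (hμ' : ∀ (K₀ : Type) [Field K₀] [NumberField K₀] [IsCyclotomicExtension {p} ℚ K₀]
        [(galRange (K := ℚ) K₀).Normal] (ηq : absoluteGaloisGroup ℚ →* ℤˣ),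
        (∀ σ ∈ galRange (K := ℚ) K₀, ηq σ = 1) → ηq ≠ 1 →
      ∀ (κ : ZpExtension ℚ p) (γ : absoluteGaloisGroup ℚ),
        κ.IsCyclotomic → κ.IsTopGenerator γ → γ ∈ galRange (K := ℚ) K₀ →
      ∀ (D : EtaSignedSelmerDualData V' κ K₀ ℚ_[p] ηq γ 1) (g : IwasawaAlgebra p),
        D.charIdeal = Ideal.span {g} → HasUnitContent g) :
    ∀ (K₀ : Type) [Field K₀] [NumberField K₀] [IsCyclotomicExtension {p} ℚ K₀]
        [(galRange (K := ℚ) K₀).Normal] (ηq : absoluteGaloisGroup ℚ →* ℤˣ),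
        (∀ σ ∈ galRange (K := ℚ) K₀, ηq σ = 1) → ηq ≠ 1 →
      ∀ (κ : ZpExtension ℚ p) (γ : absoluteGaloisGroup ℚ),
        κ.IsCyclotomic → κ.IsTopGenerator γ → γ ∈ galRange (K := ℚ) K₀ →
      ∀ (D : EtaSignedSelmerDualData V κ K₀ ℚ_[p] ηq γ 1) (g : IwasawaAlgebra p),
        D.charIdeal = Ideal.span {g} → HasUnitContent g :=
  EtaCongruentAnchor.etaMu_of_modPCongruent p (hHL_of_thm46 p h46 h22) V' V hp5 hgood' hap' hgood hap
    hcong hμ'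

/-- **`μ(X⁺(V/K_∞)^η) = 0` from a congruent UNIT-row anchor, BY NAME** (=
`EtaCongruentAnchor.etaMu_of_modPCongruent_unitRow` with `hHL` := `hHL_of_thm46`): the anchor `V′` (good,
`a_p(V′) = 0`, `V′[p] ≅ V[p]`) has an additive partner `W′` (`C′ • W′^{(p*)} = V′`, globally minimal) with
`Sel_{p^∞}(W′/ℚ) = 0` and `p ∤ Tam(W′)` — there `μ = 0` is seat g2's THEOREM
(`EtaMuBound.eta_hasUnitContent_of_selmer_trivial_of_not_dvd_tamagawa`), and Hatley–Lei transports it to `V`.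
The shape of the 14 unit-anchored non-CM rows of 19606 below `5·10⁵` (5 of rank 0, 9 of rank 1).
CONDITIONAL on the named facts `h46`, `h22` only (plus the per-row `ModPCongruent` input).
[cite: HatleyLei2019, Thm. 4.6 (§4.2)] [cite: GreenbergLNM1716, §3 Prop. 3.8, §4 Lemma 4.2]
[cite: Kobayashi2003, §4 p. 8, Thm. 9.3] -/
theorem etaMu_of_modPCongruent_unitRow (h46 : HatleyLei2019.thm46_etaSignedMu_eq_zero_iff_of_torsionIso)
    (h22 : Kobayashi2003.thm22_etaSignedSelmerDual_finite_torsion)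
    (V' : WeierstrassCurve ℚ) [V'.IsElliptic] [V'.IsGloballyMinimal]
    (W' : WeierstrassCurve ℚ) [W'.IsElliptic] [W'.IsGloballyMinimal] (C' : VariableChange ℚ)
    (V : WeierstrassCurve ℚ) [V.IsElliptic] [V.IsGloballyMinimal]
    (hp5 : 5 ≤ p) (hCV' : C' • W'.quadraticTwist ((-1) ^ (p / 2) * p) = V')
    (hgood' : V'.HasGoodReductionAtPrime p) (hap' : V'.frobeniusTrace p = 0)
    (hSel' : W'.selmerGroupPInfty p = ⊥) (hTam' : ¬ p ∣ W'.tamagawaProduct)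
    (hgood : V.HasGoodReductionAtPrime p) (hap : V.frobeniusTrace p = 0)
    (hcong : ModPCongruent V' V p) :
    ∀ (K₀ : Type) [Field K₀] [NumberField K₀] [IsCyclotomicExtension {p} ℚ K₀]
        [(galRange (K := ℚ) K₀).Normal] (ηq : absoluteGaloisGroup ℚ →* ℤˣ),
        (∀ σ ∈ galRange (K := ℚ) K₀, ηq σ = 1) → ηq ≠ 1 →
      ∀ (κ : ZpExtension ℚ p) (γ : absoluteGaloisGroup ℚ),
        κ.IsCyclotomic → κ.IsTopGenerator γ → γ ∈ galRange (K := ℚ) K₀ →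
      ∀ (D : EtaSignedSelmerDualData V κ K₀ ℚ_[p] ηq γ 1) (g : IwasawaAlgebra p),
        D.charIdeal = Ideal.span {g} → HasUnitContent g :=
  EtaCongruentAnchor.etaMu_of_modPCongruent_unitRow p (hHL_of_thm46 p h46 h22) V' W' C' V hp5 hCV' hgood'
    hap' hSel' hTam' hgood hap hcong

/-- **The INTEGRAL upper inclusion `(L_p⁺(V,η,X)) ⊆ Char(X⁺(V/K_∞)^η)` from a congruent anchor, BY NAME, on a
row of ANY rank** (= `EtaCongruentAnchor.etaUpperIntegral_of_modPCongruent` with `hHL` := `hHL_of_thm46`): the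
conclusion of skeleton v3's `stub_etaMC_nonCM_upper` at `(V,p)` from the anchor's `μ = 0` (displayed), the
named facts `h46` (Hatley–Lei Thm. 4.6), `h22` (Kobayashi Thm. 2.2 at `η`) and `h41` (the RATIONAL clause of
Thm. 4.1 at `η`; Gauss' lemma turns its `pⁿ` into the integral inclusion once `p ∤ g`). CONDITIONAL.
[cite: HatleyLei2019, Thm. 4.6 (§4.2)] [cite: Kobayashi2003, Thm. 4.1 first display (p. 8), Thm. 2.2 (p. 5)]
[cite: GreenbergVatsal2000, p. 2 (2)] -/
theorem etaUpperIntegral_of_modPCongruent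
    (h46 : HatleyLei2019.thm46_etaSignedMu_eq_zero_iff_of_torsionIso)
    (h22 : Kobayashi2003.thm22_etaSignedSelmerDual_finite_torsion)
    (h41 : Kobayashi2003.thm41_plusEtaCharIdeal_dvd)
    (V' : WeierstrassCurve ℚ) [V'.IsElliptic] [V'.IsGloballyMinimal]
    (V : WeierstrassCurve ℚ) [V.IsElliptic] [V.IsGloballyMinimal]
    (hp5 : 5 ≤ p) (hgood' : V'.HasGoodReductionAtPrime p) (hap' : V'.frobeniusTrace p = 0)
    (hgood : V.HasGoodReductionAtPrime p) (hap : V.frobeniusTrace p = 0)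
    (hcong : ModPCongruent V' V p)
    (hμ' : ∀ (K₀ : Type) [Field K₀] [NumberField K₀] [IsCyclotomicExtension {p} ℚ K₀]
        [(galRange (K := ℚ) K₀).Normal] (ηq : absoluteGaloisGroup ℚ →* ℤˣ),
        (∀ σ ∈ galRange (K := ℚ) K₀, ηq σ = 1) → ηq ≠ 1 →
      ∀ (κ : ZpExtension ℚ p) (γ : absoluteGaloisGroup ℚ),
        κ.IsCyclotomic → κ.IsTopGenerator γ → γ ∈ galRange (K := ℚ) K₀ →
      ∀ (D : EtaSignedSelmerDualData V' κ K₀ ℚ_[p] ηq γ 1) (g : IwasawaAlgebra p),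
        D.charIdeal = Ideal.span {g} → HasUnitContent g) :
    ∀ (K₀ : Type) [Field K₀] [NumberField K₀] [IsCyclotomicExtension {p} ℚ K₀]
        [(galRange (K := ℚ) K₀).Normal] (ηq : absoluteGaloisGroup ℚ →* ℤˣ),
        (∀ σ ∈ galRange (K := ℚ) K₀, ηq σ = 1) → ηq ≠ 1 →
      ∀ {N : ℕ} [NeZero N] {f : CuspForm (Gamma0 N) 2},
        p ≠ 2 → V.HasGoodReductionAtPrime p → V.frobeniusTrace p = 0 → IsNewformOf V f →
      ∀ (ϖ : ℚ), (if Even (p / 2) then (ϖ : ℝ) * V.realPeriodRat = plusPeriod f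
          else (ϖ : ℝ) * V.imaginaryPeriodRat = minusPeriod f) →
      ∀ (Lη : IwasawaAlgebra p), IsQuadraticBranchPlusLFunction f p ϖ Lη →
      ∀ (κ : ZpExtension ℚ p) (γ : absoluteGaloisGroup ℚ),
        κ.IsCyclotomic → κ.IsTopGenerator γ → γ ∈ galRange (K := ℚ) K₀ → IsCyclotomicVariable p γ →
      ∀ (D : EtaSignedSelmerDualData V κ K₀ ℚ_[p] ηq γ 1), Ideal.span {Lη} ≤ D.charIdeal :=
  EtaCongruentAnchor.etaUpperIntegral_of_modPCongruent p (hHL_of_thm46 p h46 h22) h22 h41 V' V hp5 hgood'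
    hap' hgood hap hcong hμ'

/-- **The integral upper inclusion at `η` from a congruent UNIT-row anchor, BY NAME, any rank at `V`** (=
`EtaCongruentAnchor.etaUpperIntegral_of_modPCongruent_unitRow` with `hHL` := `hHL_of_thm46`): anchor `V′` with
an additive partner `W′`, `Sel_{p^∞}(W′/ℚ) = 0`, `p ∤ Tam(W′)` (so `X⁺(V′/K_∞)^η = 0`, seat g2), `V′[p] ≅ V[p]`.
On the 9 unit-anchored non-CM RANK-ONE rows of 19606 below `5·10⁵` this is the conclusion of
`stub_etaMC_nonCM_upper` modulo NAMED facts (`h46`, `h22`, `h41`) + the Kraus–Oesterlé certificate of the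
congruence (kit j270714) — no displayed transfer any more. CONDITIONAL; nothing booked.
[cite: HatleyLei2019, Thm. 4.6 (§4.2)] [cite: Kobayashi2003, Thm. 4.1 (p. 8)]
[cite: GreenbergLNM1716, §3 Prop. 3.8] [cite: KrausOesterle1992, Prop. 4] -/
theorem etaUpperIntegral_of_modPCongruent_unitRow
    (h46 : HatleyLei2019.thm46_etaSignedMu_eq_zero_iff_of_torsionIso)
    (h22 : Kobayashi2003.thm22_etaSignedSelmerDual_finite_torsion)
    (h41 : Kobayashi2003.thm41_plusEtaCharIdeal_dvd)
    (V' : WeierstrassCurve ℚ) [V'.IsElliptic] [V'.IsGloballyMinimal]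
    (W' : WeierstrassCurve ℚ) [W'.IsElliptic] [W'.IsGloballyMinimal] (C' : VariableChange ℚ)
    (V : WeierstrassCurve ℚ) [V.IsElliptic] [V.IsGloballyMinimal]
    (hp5 : 5 ≤ p) (hCV' : C' • W'.quadraticTwist ((-1) ^ (p / 2) * p) = V')
    (hgood' : V'.HasGoodReductionAtPrime p) (hap' : V'.frobeniusTrace p = 0)
    (hSel' : W'.selmerGroupPInfty p = ⊥) (hTam' : ¬ p ∣ W'.tamagawaProduct)
    (hgood : V.HasGoodReductionAtPrime p) (hap : V.frobeniusTrace p = 0)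
    (hcong : ModPCongruent V' V p) :
    ∀ (K₀ : Type) [Field K₀] [NumberField K₀] [IsCyclotomicExtension {p} ℚ K₀]
        [(galRange (K := ℚ) K₀).Normal] (ηq : absoluteGaloisGroup ℚ →* ℤˣ),
        (∀ σ ∈ galRange (K := ℚ) K₀, ηq σ = 1) → ηq ≠ 1 →
      ∀ {N : ℕ} [NeZero N] {f : CuspForm (Gamma0 N) 2},
        p ≠ 2 → V.HasGoodReductionAtPrime p → V.frobeniusTrace p = 0 → IsNewformOf V f →
      ∀ (ϖ : ℚ), (if Even (p / 2) then (ϖ : ℝ) * V.realPeriodRat = plusPeriod f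
          else (ϖ : ℝ) * V.imaginaryPeriodRat = minusPeriod f) →
      ∀ (Lη : IwasawaAlgebra p), IsQuadraticBranchPlusLFunction f p ϖ Lη →
      ∀ (κ : ZpExtension ℚ p) (γ : absoluteGaloisGroup ℚ),
        κ.IsCyclotomic → κ.IsTopGenerator γ → γ ∈ galRange (K := ℚ) K₀ → IsCyclotomicVariable p γ →
      ∀ (D : EtaSignedSelmerDualData V κ K₀ ℚ_[p] ηq γ 1), Ideal.span {Lη} ≤ D.charIdeal :=
  EtaCongruentAnchor.etaUpperIntegral_of_modPCongruent_unitRow p (hHL_of_thm46 p h46 h22) h22 h41 V' W' C' V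
    hp5 hCV' hgood' hap' hSel' hTam' hgood hap hcong

/-- **(C1⁺_η)(V,p) on a rank-`0` row FROM A CONGRUENT ANCHOR, BY NAME** (=
`EtaCongruentAnchor.quadraticBranchPlusEtaMainConjectureAt_of_modPCongruent_of_missingLowerBoundAt` with `hHL`
:= `hHL_of_thm46`): `W` globally minimal, `p ≥ 5`, `V` a globally minimal model of `W^{(p*)}` good at `p` with
`a_p(V) = 0`, `L(W,1) ≠ 0`, `Typed.MissingLowerBoundAt W p` (L₀, INPUT); an anchor `V′` (good, `a_p(V′) = 0`,
`V′[p] ≅ V[p]`) with `μ = 0` for every `η`-datum (displayed); named facts `h46`, `hPT`, `hmod`, `hGZK`, `h22`,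
`h41`, `hKO`. On the 7 Tamagawa-`5` rows of the census the anchors are the rank-one CM pairs (2700p1, 675a1,
14400l1), whose `μ = 0` is the open `μ`-part of the CM `η`-main conjecture. CONDITIONAL; nothing booked.
[cite: HatleyLei2019, Thm. 4.6 (§4.2)] [cite: Kobayashi2003, §4 Even main conjecture and Thm. 4.1 (p. 8)]
[cite: KitajimaOtsuki2018, Thm. 1.3] [cite: Miller2011LMS, Def. 1.1] [cite: KrausOesterle1992, Prop. 4] -/
theorem quadraticBranchPlusEtaMainConjectureAt_of_modPCongruent_of_missingLowerBoundAt
    (h46 : HatleyLei2019.thm46_etaSignedMu_eq_zero_iff_of_torsionIso)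
    (hPT : poitouTate_selmerStructure_duality_real ℚ) (hmod : hasEntireLFunction_rat)
    (hGZK : rank_eq_analyticRank_of_analyticRank_le_one)
    (h22 : Kobayashi2003.thm22_etaSignedSelmerDual_finite_torsion)
    (h41 : Kobayashi2003.thm41_plusEtaCharIdeal_dvd)
    (hKO : KitajimaOtsuki2018.mainThm13_etaSignedSelmerDual_noFiniteSubmodule)
    (W : WeierstrassCurve ℚ) [W.IsElliptic] [W.IsGloballyMinimal]
    (V : WeierstrassCurve ℚ) [V.IsElliptic] [V.IsGloballyMinimal] (C : VariableChange ℚ)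
    (hp5 : 5 ≤ p) (hCV : C • W.quadraticTwist ((-1) ^ (p / 2) * p) = V)
    (hgood : V.HasGoodReductionAtPrime p) (hap : V.frobeniusTrace p = 0)
    (hLW : W.entireLFunction 1 ≠ 0) (hlow : MissingLowerBoundAt W p)
    (V' : WeierstrassCurve ℚ) [V'.IsElliptic] [V'.IsGloballyMinimal]
    (hgood' : V'.HasGoodReductionAtPrime p) (hap' : V'.frobeniusTrace p = 0)
    (hcong : ModPCongruent V' V p)
    (hμ' : ∀ (K₀ : Type) [Field K₀] [NumberField K₀] [IsCyclotomicExtension {p} ℚ K₀]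
        [(galRange (K := ℚ) K₀).Normal] (ηq : absoluteGaloisGroup ℚ →* ℤˣ),
        (∀ σ ∈ galRange (K := ℚ) K₀, ηq σ = 1) → ηq ≠ 1 →
      ∀ (κ : ZpExtension ℚ p) (γ : absoluteGaloisGroup ℚ),
        κ.IsCyclotomic → κ.IsTopGenerator γ → γ ∈ galRange (K := ℚ) K₀ →
      ∀ (D : EtaSignedSelmerDualData V' κ K₀ ℚ_[p] ηq γ 1) (g : IwasawaAlgebra p),
        D.charIdeal = Ideal.span {g} → HasUnitContent g) :
    QuadraticBranchPlusEtaMainConjectureAt V p :=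
  EtaCongruentAnchor.quadraticBranchPlusEtaMainConjectureAt_of_modPCongruent_of_missingLowerBoundAt p
    (hHL_of_thm46 p h46 h22) hPT hmod hGZK h22 h41 hKO W V C hp5 hCV hgood hap hLW hlow V' hgood' hap' hcong
    hμ'

end EtaCongruentAnchorByName

end Summit.BirchSwinnertonDyer.BirchSwinnertonDyer.Theorems

end
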